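import Summits.ResolutionOfSingularities.ResolutionOfSingularities.Theorems.FrobeniusLadderFInjectiveMacaulayficationFedderOrigin
import Summits.ResolutionOfSingularities.ResolutionOfSingularities.Theorems.FrobeniusLadderFInjectiveMacaulayficationQuotLocalizationIso
import Summits.ResolutionOfSingularities.ResolutionOfSingularities.Theorems.FrobeniusLadderFInjectiveMacaulayficationDegreeZeroDescentLocal
import Mathlib.RingTheory.Localization.AtPrime.Basic
import Mathlib.RingTheory.Ideal.IsPrimary
import HarnessLib

/-!
# Fedder's test at an arbitrary closed point of affine space (general `n` and `p`)

Support file for crux stmt-ResolutionOfSingularities-15315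
(`FrobeniusLadder.FInjectiveMacaulayfication`, line `Sketch`, lead seat c7): stub
`stub_fedderAtMaximalIdeal` of the §14 ENGINE package (the calibration recipe "certified one-step
point blow-up of a hypersurface" needs, at each SINGULAR closed point of a chart `k[X]/(g)`, a
certificate that the local ring satisfies the per-stalk clause of the crux; this file provides it at an
ARBITRARY closed point — possibly with non-rational residue field — through any finite generating family
`a₁, …, a_m` of the maximal ideal `P = Q ∩ k[X]`).

Let `k` be a field of characteristic `p`, `S = k[X₀, …, X_{n-1}]`, `P = (a₁, …, a_m)` a maximal ideal of
`S`, `R = S_P` (a regular local ring of characteristic `p`) and `g ∈ P`, `g ≠ 0`.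

* `algebraMap_pow_mem_frobeniusPower_maximalIdeal_iff` — the Fedder test moves between `S` and `R`:
  `(g)^r ∈ 𝔪_R^[p]` in `R` iff `g^r ∈ (a₁^p, …, a_m^p)` in `S` (`𝔪_R = P R`, `(P R)^[p] = P^[p] R`,
  `P^[p] = (aᵢ^p)` by `frobeniusPower_span`, and `(aᵢ^p)` is `P`-primary — its radical is the maximal
  ideal `P` — hence contracted from `R`). This is the template
  `Fedder.algebraMap_pow_mem_frobeniusPower_maximalIdeal_iff` (the case `a = X`) verbatim with `X ↦ a`.
* `fedder_criterion_maximalIdeal` — `R/(g)` satisfies the clause iff `g^(p-1) ∉ (a₁^p, …, a_m^p)`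
  (`Fedder.fedder_hypersurface_clause_iff` in `R`, moved to `S` by the previous bullet).
* `stub_fedderAtMaximalIdeal` — the registered form: for a maximal ideal `Q` of `S/(g)` with
  `Q ∩ S = (a₁, …, a_m)`, if `g^(p-1) ∉ (a₁^p, …, a_m^p)` then `(S/(g))_Q` satisfies the clause
  (transport along `R/(g) ≅ (S/(g))_Q`, `QuotLocalizationIso.stub_quotLocalizationIso`, by
  `DegreeZeroDescent.inlineClause_of_ringEquiv`).

References: [Fedder1983] R. Fedder, F-purity and rational singularity, Trans. AMS 278 (1983),
Prop. 1.7 and Thm. 1.12.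
-/

-- single-problem summit: the doubled namespace component is forced
set_option linter.dupNamespace false

namespace Summit.ResolutionOfSingularities.ResolutionOfSingularities.Theorems.FInjectiveMacaulayfication.FedderAtMaximalIdeal

open MvPolynomial IsLocalRing Literature.RingTheory.TightClosure
open Summit.ResolutionOfSingularities.ResolutionOfSingularities.Theorems.FInjectiveMacaulayfication

section MaximalIdeal

variable (k : Type) [Field k] (n m : ℕ) (p : ℕ) [Fact p.Prime] [CharP k p]

/-- **Transport of Fedder's test between `S = k[X]` and the local ring `R = S_P` at a closed point**
(`P = (a₁, …, a_m)` maximal): for `g ∈ S` and `r : ℕ`, the image of `g^r` lies in `𝔪_R^[p]` iff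
`g^r ∈ (a₁^p, …, a_m^p)`. (`𝔪_R = P R`; Frobenius powers commute with extension; `(aᵢ^p) = P^[p]`
is `P`-primary, hence contracted from `R`.) [cite: Fedder1983, Prop. 1.7] -/
-- adapted from `Fedder.algebraMap_pow_mem_frobeniusPower_maximalIdeal_iff` (the case `a = X`)
theorem algebraMap_pow_mem_frobeniusPower_maximalIdeal_iff (P : Ideal (MvPolynomial (Fin n) k))
    [P.IsMaximal] (a : Fin m → MvPolynomial (Fin n) k) (hP : P = Ideal.span (Set.range a))
    [CharP (Localization.AtPrime P) p] (g : MvPolynomial (Fin n) k) (r : ℕ) :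
    (algebraMap (MvPolynomial (Fin n) k) (Localization.AtPrime P) g) ^ r ∈
        frobeniusPower p (maximalIdeal (Localization.AtPrime P)) ↔
      g ^ r ∈ Ideal.span (Set.range fun i : Fin m => a i ^ p) := by
  set Q : Ideal (MvPolynomial (Fin n) k) := Ideal.span (Set.range fun i : Fin m => a i ^ p) with hQ
  -- `P^[p] = Q`
  have hPQ : frobeniusPower p P = Q := by
    have h := frobeniusPower_span (R := MvPolynomial (Fin n) k) p 1 (Set.range a)
    rw [pow_one, ← hP, ← Set.range_comp] at h
    exact h
  -- `𝔪_R^[p] = Q R`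
  have hmR : frobeniusPower p (maximalIdeal (Localization.AtPrime P)) =
      Q.map (algebraMap (MvPolynomial (Fin n) k) (Localization.AtPrime P)) := by
    rw [← IsLocalization.AtPrime.map_eq_maximalIdeal P (Localization.AtPrime P), ← pow_one p,
      Fedder.frobeniusPower_map p _ 1, pow_one, hPQ]
  rw [hmR, ← map_pow]
  constructor
  · -- contraction: `Q` is `P`-primary
    intro hmem
    have hp0 : p ≠ 0 := (Fact.out : p.Prime).ne_zero
    have hQP : Q ≤ P := by
      rw [hQ, Ideal.span_le]
      rintro _ ⟨i, rfl⟩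
      exact Ideal.pow_mem_of_mem P (hP ▸ Ideal.subset_span ⟨i, rfl⟩) p (Nat.pos_of_ne_zero hp0)
    have hrad : Q.radical = P := by
      refine le_antisymm ((Ideal.IsMaximal.isPrime' P).radical_le_iff.mpr hQP) ?_
      rw [hP, Ideal.span_le]
      rintro _ ⟨i, rfl⟩
      exact ⟨p, Ideal.subset_span ⟨i, rfl⟩⟩
    have hprim : Q.IsPrimary := Ideal.isPrimary_of_isMaximal_radical (hrad ▸ inferInstance)
    rw [IsLocalization.mem_map_algebraMap_iff P.primeCompl (Localization.AtPrime P)] at hmem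
    obtain ⟨⟨⟨b, hb⟩, ⟨s, hs⟩⟩, h⟩ := hmem
    dsimp only at h
    rw [← map_mul] at h
    have hinj : Function.Injective (algebraMap (MvPolynomial (Fin n) k) (Localization.AtPrime P)) :=
      IsLocalization.injective (Localization.AtPrime P) P.primeCompl_le_nonZeroDivisors
    have h' : g ^ r * s ∈ Q := by rw [hinj h]; exact hb
    rcases (Ideal.isPrimary_iff.mp hprim).2 h' with h1 | h1
    · exact h1
    · exact absurd (hrad ▸ h1) hs
  · -- extension
    intro hmem
    exact Ideal.mem_map_of_mem _ hmem

/-- **Fedder's test at a closed point of `𝔸ⁿ`, local ring upstairs.** For a field `k` of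
characteristic `p`, `S = k[X₀, …, X_{n-1}]`, a maximal ideal `P = (a₁, …, a_m)`, `R = S_P` and `g ∈ P`,
`g ≠ 0`: the hypersurface local ring `R/(g)` satisfies the per-stalk clause of crux
`FInjectiveMacaulayfication` — every system of parameters weakly regular and every parameter ideal
Frobenius closed — **iff** `g^(p-1) ∉ (a₁^p, …, a_m^p)`. (`Fedder.fedder_hypersurface_clause_iff` in the
regular local ring `R`, moved to `S` by `algebraMap_pow_mem_frobeniusPower_maximalIdeal_iff`.)
[cite: Fedder1983, Prop. 1.7 and Thm. 1.12] -/
-- adapted from `Fedder.fedder_criterion_origin` (the case `a = X`)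
theorem fedder_criterion_maximalIdeal (P : Ideal (MvPolynomial (Fin n) k)) [P.IsMaximal]
    (a : Fin m → MvPolynomial (Fin n) k) (hP : P = Ideal.span (Set.range a))
    (g : MvPolynomial (Fin n) k) (hgP : g ∈ P) (hg0 : g ≠ 0) :
    (∀ d : ℕ, ringKrullDim (Localization.AtPrime P ⧸ Ideal.span
        {algebraMap (MvPolynomial (Fin n) k) (Localization.AtPrime P) g}) = d →
      ∀ s : Fin d → Localization.AtPrime P ⧸ Ideal.span
          {algebraMap (MvPolynomial (Fin n) k) (Localization.AtPrime P) g},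
        Ideal.IsMaximal (Ideal.radical (Ideal.span (Set.range s))) →
          RingTheory.Sequence.IsWeaklyRegular (Localization.AtPrime P ⧸ Ideal.span
              {algebraMap (MvPolynomial (Fin n) k) (Localization.AtPrime P) g}) (List.ofFn s) ∧
          ∀ y : Localization.AtPrime P ⧸ Ideal.span
              {algebraMap (MvPolynomial (Fin n) k) (Localization.AtPrime P) g},
            (∃ e : ℕ, y ^ p ^ e ∈ Ideal.span ((fun z : Localization.AtPrime P ⧸ Ideal.span
                {algebraMap (MvPolynomial (Fin n) k) (Localization.AtPrime P) g} => z ^ p ^ e) ''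
                  (Ideal.span (Set.range s) : Set (Localization.AtPrime P ⧸ Ideal.span
                    {algebraMap (MvPolynomial (Fin n) k) (Localization.AtPrime P) g})))) →
              y ∈ Ideal.span (Set.range s)) ↔
      g ^ (p - 1) ∉ Ideal.span (Set.range fun i : Fin m => a i ^ p) := by
  -- `R = S_P` is a regular local ring of characteristic `p`, `g ↦` a non-zero element of `𝔪_R`
  haveI : IsRegularLocalRing (Localization.AtPrime P) := IsRegularRing.isRegularLocalRing_localization P
  have hinj : Function.Injective (algebraMap (MvPolynomial (Fin n) k) (Localization.AtPrime P)) :=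
    IsLocalization.injective (Localization.AtPrime P) P.primeCompl_le_nonZeroDivisors
  haveI : CharP (Localization.AtPrime P) p := charP_of_injective_algebraMap hinj p
  have hgm : algebraMap (MvPolynomial (Fin n) k) (Localization.AtPrime P) g ∈
      maximalIdeal (Localization.AtPrime P) := by
    rw [← IsLocalization.AtPrime.map_eq_maximalIdeal P (Localization.AtPrime P)]
    exact Ideal.mem_map_of_mem _ hgP
  have hg0' : algebraMap (MvPolynomial (Fin n) k) (Localization.AtPrime P) g ≠ 0 := by
    intro h
    exact hg0 (hinj (by rw [h, map_zero]))
  rw [Fedder.fedder_hypersurface_clause_iff p hgm hg0',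
    algebraMap_pow_mem_frobeniusPower_maximalIdeal_iff k n m p P a hP g (p - 1)]

end MaximalIdeal

/-! ## Registered form -/

/-- **FEDDER'S TEST AT AN ARBITRARY CLOSED POINT** (stub `stub_fedderAtMaximalIdeal` of line `Sketch`;
general `n`, `p`; completes the discharger set of §14 beyond `k`-rational points): for a field `k` of
characteristic `p`, `g ∈ k[X₀, …, X_{n-1}]` non-zero and a maximal ideal `Q` of `k[X]/(g)` whose
contraction to `k[X]` is generated by `a₁, …, a_m` (any generators — e.g. the triangular
Nullstellensatz generators of a non-rational closed point), if `g^(p-1) ∉ (a₁^p, …, a_m^p)` then the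
local ring `(k[X]/(g))_Q` satisfies the per-stalk clause of `FrobeniusLadder.FInjectiveMacaulayfication`:
every system of parameters is weakly regular and generates a Frobenius closed ideal.
(`fedder_criterion_maximalIdeal` in the regular local ring `k[X]_P`, `P = Q ∩ k[X] = (a)`, then
`QuotLocalizationIso.stub_quotLocalizationIso` + `DegreeZeroDescent.inlineClause_of_ringEquiv`.)
[cite: Fedder1983, Prop. 1.7 and Thm. 1.12] -/
theorem stub_fedderAtMaximalIdeal : ∀ (p : ℕ) [Fact p.Prime] (k : Type) [Field k] [CharP k p] (n m : ℕ)
    (a : Fin m → MvPolynomial (Fin n) k) (g : MvPolynomial (Fin n) k)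
    (Q : Ideal (MvPolynomial (Fin n) k ⧸ Ideal.span {g})) [Q.IsMaximal],
    Q.comap (Ideal.Quotient.mk (Ideal.span {g})) = Ideal.span (Set.range a) → g ≠ 0 →
    g ^ (p - 1) ∉ Ideal.span (Set.range fun i : Fin m => a i ^ p) →
    ∀ d : ℕ, ringKrullDim (Localization.AtPrime Q) = d → ∀ s : Fin d → Localization.AtPrime Q,
      (Ideal.span (Set.range s)).radical.IsMaximal →
        RingTheory.Sequence.IsWeaklyRegular (Localization.AtPrime Q) (List.ofFn s) ∧
        ∀ y : Localization.AtPrime Q, (∃ e : ℕ, y ^ p ^ e ∈ Ideal.span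
          ((fun z : Localization.AtPrime Q => z ^ p ^ e) ''
            (Ideal.span (Set.range s) : Set (Localization.AtPrime Q)))) → y ∈ Ideal.span (Set.range s) := by
  intro p _ k _ _ n m a g Q _ hQ hg0 hfed
  -- `P = Q ∩ S` is a maximal ideal of `S` (contraction of a maximal ideal along a surjection)
  haveI hPmax : (Q.comap (Ideal.Quotient.mk (Ideal.span {g}))).IsMaximal :=
    Ideal.comap_isMaximal_of_surjective _ Ideal.Quotient.mk_surjective
  -- `g ∈ P` since `g ↦ 0 ∈ Q`
  have hgP : g ∈ Q.comap (Ideal.Quotient.mk (Ideal.span {g})) := by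
    rw [Ideal.mem_comap, Ideal.Quotient.eq_zero_iff_mem.mpr (Ideal.mem_span_singleton_self g)]
    exact Q.zero_mem
  -- Fedder upstairs in `S_P/(g)`, then transport along `S_P/(g) ≅ (S/(g))_Q`
  have hL := (fedder_criterion_maximalIdeal k n m p (Q.comap (Ideal.Quotient.mk (Ideal.span {g})))
    a hQ g hgP hg0).mpr hfed
  obtain ⟨e₁⟩ := QuotLocalizationIso.stub_quotLocalizationIso (MvPolynomial (Fin n) k) g
    (Q.comap (Ideal.Quotient.mk (Ideal.span {g}))) Q rfl
  have key := DegreeZeroDescent.inlineClause_of_ringEquiv p e₁ hL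
  exact key

end Summit.ResolutionOfSingularities.ResolutionOfSingularities.Theorems.FInjectiveMacaulayfication.FedderAtMaximalIdeal
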